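import Mathlib
import Literature.NumberTheory.LFunctions.WeilMarkovQuadratic
import Literature.NumberTheory.LFunctions.WeilExplicit
import Summits.RiemannHypothesis.RiemannHypothesis.Theorems.PfPersistenceWindowIncrementParseval
import HarnessLib

/-!
# Window coercivity: the Dirichlet energy controls `‖g‖²` on high modes

Sub-problem `RiemannHypothesis`, cell `pub-rhpf` (Pf-persistence **mechanism / rigidity campaign; no RH
claims**).  Second of three files of **GAL-7 (fixed-window finiteness of the negative index)**.

Ingredients and result, all RH-free and elementary:

* `inv_two_mul_le_weilArchDensity`: the archimedean jump density of the Weil–Markov decomposition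
  satisfies `e^{t/2}/(2 sinh t) ≥ 1/(2t)` on `(0, 1]`;
* `sinSqLogInt`: `S(X) = ∫₀^X sin²u/u du`, monotone, with the oscillation-free lower bound
  `S(Y) ≥ ½ log(2Y/π)` for `Y ≥ π/2` (`half_log_le_sinSqLogInt`: compare `sin²u/u` with
  `cos²u/(u + π/2)` and use `sin² + cos² = 1`);
* `weilDirichletEnergy_ge_of_winCoeff_eq_zero` (**coercivity**): for a Weil test `g` supported in
  `[-a, a]` whose doubled-window Fourier coefficients `ĉ_k` (file 1, `winCoeff`) vanish for `|k| ≤ N`,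
  `2 · S(π (N+1) m / 4a) · ‖g‖₂² ≤ 𝓔_a(g)`, `m = min(1, a/2)`,
  from `𝓔_a(g) ≥ ∫₀^m D_t(g)/(2t) dt` and the increment Parseval identity
  `D_t(g) = 16a Σ_k |ĉ_k|² sin²(πkt/4a)`.

[cite: Yoshida1992, §1 p. 282 and Lemma 3] [cite: Bombieri2000Weil, Thm 2 (p. 193)]
-/

noncomputable section

open MeasureTheory Set Filter Topology
open scoped Real

set_option linter.dupNamespace false

namespace Summit.RiemannHypothesis.RiemannHypothesis.Theorems.PfPersistence

open Literature.NumberTheory.LFunctions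

variable {a t : ℝ} {g : ℝ → ℂ}

/-! ## The archimedean density dominates `1/(2t)` near `0` -/

/-- `sinh t ≤ t e^{t/2}` for `0 < t ≤ 1` (from `e^t ≤ 1 + t + t²`, `e^{-t} ≥ 1 − t`,
`e^{t/2} ≥ 1 + t/2`). [folklore] -/
theorem sinh_le_mul_exp_half {t : ℝ} (ht0 : 0 < t) (ht1 : t ≤ 1) :
    Real.sinh t ≤ t * Real.exp (t / 2) := by
  rw [Real.sinh_eq]
  have h1 : |Real.exp t - 1 - t| ≤ t ^ 2 :=
    Real.abs_exp_sub_one_sub_id_le (by rw [abs_of_pos ht0]; exact ht1)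
  have h2 : Real.exp t ≤ 1 + t + t ^ 2 := by
    have := (abs_le.1 h1).2
    linarith
  have h3 : 1 - t ≤ Real.exp (-t) := by
    have := Real.add_one_le_exp (-t)
    linarith
  have h4 : 1 + t / 2 ≤ Real.exp (t / 2) := by
    have := Real.add_one_le_exp (t / 2)
    linarith
  have h5 : t * (1 + t / 2) ≤ t * Real.exp (t / 2) := mul_le_mul_of_nonneg_left h4 ht0.le
  nlinarith

/-- **`e^{t/2}/(2 sinh t) ≥ 1/(2t)` on `(0, 1]`.** [folklore] -/
theorem inv_two_mul_le_weilArchDensity {t : ℝ} (ht0 : 0 < t) (ht1 : t ≤ 1) :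
    1 / (2 * t) ≤ weilArchDensity t := by
  unfold weilArchDensity
  have hs : 0 < Real.sinh t := Real.sinh_pos_iff.2 ht0
  rw [div_le_div_iff₀ (by positivity) (by positivity)]
  have := sinh_le_mul_exp_half ht0 ht1
  nlinarith [Real.exp_pos (t / 2)]

/-! ## The logarithmic sine-square integral `S(X) = ∫₀^X sin²u / u du` -/

/-- The integrand `sin² u / u` (value `0` at `u = 0`). [folklore] -/
def sinSqDiv (u : ℝ) : ℝ := Real.sin u ^ 2 / u

/-- `S(X) = ∫₀^X sin² u / u du`. [folklore] -/
def sinSqLogInt (X : ℝ) : ℝ := ∫ u in (0 : ℝ)..X, sinSqDiv u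

/-- `sin² u / u = sin u · sinc u`. [folklore] -/
theorem sinSqDiv_eq_sin_mul_sinc (u : ℝ) : sinSqDiv u = Real.sin u * Real.sinc u := by
  unfold sinSqDiv
  by_cases hu : u = 0
  · simp [hu]
  · rw [Real.sinc_of_ne_zero hu, sq]
    ring

/-- `u ↦ sin² u / u` is continuous on `ℝ`. [folklore] -/
theorem continuous_sinSqDiv : Continuous sinSqDiv := by
  have : sinSqDiv = fun u ↦ Real.sin u * Real.sinc u := funext sinSqDiv_eq_sin_mul_sinc
  rw [this]
  exact Real.continuous_sin.mul Real.continuous_sinc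

/-- `sin² u / u ≥ 0` for `u ≥ 0`. [folklore] -/
theorem sinSqDiv_nonneg {u : ℝ} (hu : 0 ≤ u) : 0 ≤ sinSqDiv u :=
  div_nonneg (sq_nonneg _) hu

/-- `S(X) ≥ 0` for `X ≥ 0`. [folklore] -/
theorem sinSqLogInt_nonneg {X : ℝ} (hX : 0 ≤ X) : 0 ≤ sinSqLogInt X :=
  intervalIntegral.integral_nonneg hX fun _ hu ↦ sinSqDiv_nonneg hu.1

/-- `S` is monotone on `[0, ∞)`: `S(X) ≤ S(Y)` for `0 ≤ X ≤ Y`. [folklore] -/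
theorem sinSqLogInt_mono {X Y : ℝ} (hX : 0 ≤ X) (hXY : X ≤ Y) : sinSqLogInt X ≤ sinSqLogInt Y := by
  unfold sinSqLogInt
  have hadd := intervalIntegral.integral_add_adjacent_intervals (μ := volume) (a := 0) (b := X) (c := Y)
    (continuous_sinSqDiv.intervalIntegrable _ _) (continuous_sinSqDiv.intervalIntegrable _ _)
  have : 0 ≤ ∫ u in X..Y, sinSqDiv u :=
    intervalIntegral.integral_nonneg hXY fun u hu ↦ sinSqDiv_nonneg (hX.trans hu.1)
  linarith

/-- Scaling: `∫₀^m sin²(c t)/t dt = S(c m)` for `c > 0`. [folklore] -/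
theorem integral_sin_sq_div_eq_sinSqLogInt {c : ℝ} (hc : 0 < c) (m : ℝ) :
    ∫ t in (0 : ℝ)..m, Real.sin (c * t) ^ 2 / t = sinSqLogInt (c * m) := by
  have h1 : ∀ t : ℝ, Real.sin (c * t) ^ 2 / t = c * sinSqDiv (c * t) := by
    intro t
    unfold sinSqDiv
    by_cases ht : t = 0
    · simp [ht]
    · field_simp
  simp_rw [h1]
  rw [intervalIntegral.integral_const_mul, intervalIntegral.integral_comp_mul_left sinSqDiv hc.ne',
    mul_zero, smul_eq_mul, ← mul_assoc, mul_inv_cancel₀ hc.ne', one_mul]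
  rfl

/-- The scaled integrand `t ↦ sin²(c t)/t` is continuous. [folklore] -/
theorem continuous_sin_sq_mul_div (c : ℝ) : Continuous fun t : ℝ ↦ Real.sin (c * t) ^ 2 / t := by
  have h1 : (fun t : ℝ ↦ Real.sin (c * t) ^ 2 / t) = fun t ↦ c * sinSqDiv (c * t) := by
    funext t
    unfold sinSqDiv
    by_cases ht : t = 0
    · simp [ht]
    · by_cases hc : c = 0
      · simp [hc]
      · field_simp
  rw [h1]
  exact continuous_const.mul (continuous_sinSqDiv.comp (continuous_const.mul continuous_id))

/-- **Logarithmic growth of `S`.** For `Y ≥ π/2`: `S(Y) ≥ ½ log(2Y/π)`.  Proof without oscillatory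
estimates: with `X = Y − π/2`, `S(X) ≥ ∫₀^X sin²u/(u+π/2)`, `S(Y) ≥ ∫₀^X cos²u/(u+π/2)`
(substitute `v = u + π/2`), the two integrands add up to `1/(u+π/2)` with integral `log(2Y/π)`, and
`S(X) ≤ S(Y)`. [folklore] -/
theorem half_log_le_sinSqLogInt {Y : ℝ} (hY : π / 2 ≤ Y) :
    1 / 2 * Real.log (2 * Y / π) ≤ sinSqLogInt Y := by
  have hπ : 0 < π / 2 := by positivity
  set X : ℝ := Y - π / 2 with hXdef
  have hX0 : 0 ≤ X := by linarith
  have hY' : X + π / 2 = Y := by ring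
  have hden : ∀ u ∈ uIcc (0 : ℝ) X, u + π / 2 ≠ 0 := fun u hu ↦ by
    rw [uIcc_of_le hX0] at hu
    linarith [hu.1]
  have hcs : ContinuousOn (fun u : ℝ ↦ Real.sin u ^ 2 / (u + π / 2)) (uIcc 0 X) :=
    (by fun_prop : Continuous fun u : ℝ ↦ Real.sin u ^ 2).continuousOn.div
      (by fun_prop : Continuous fun u : ℝ ↦ u + π / 2).continuousOn hden
  have hcc : ContinuousOn (fun u : ℝ ↦ Real.cos u ^ 2 / (u + π / 2)) (uIcc 0 X) :=
    (by fun_prop : Continuous fun u : ℝ ↦ Real.cos u ^ 2).continuousOn.div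
      (by fun_prop : Continuous fun u : ℝ ↦ u + π / 2).continuousOn hden
  -- (1) `S(X) ≥ ∫₀^X sin² u / (u + π/2)`
  have h1 : ∫ u in (0 : ℝ)..X, Real.sin u ^ 2 / (u + π / 2) ≤ sinSqLogInt X := by
    unfold sinSqLogInt
    refine intervalIntegral.integral_mono_on hX0 hcs.intervalIntegrable
      (continuous_sinSqDiv.intervalIntegrable _ _) fun u hu ↦ ?_
    unfold sinSqDiv
    rcases eq_or_lt_of_le hu.1 with h0 | hpos
    · rw [← h0]
      simp
    · exact div_le_div_of_nonneg_left (sq_nonneg _) hpos (by linarith)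
  -- (2) `∫₀^X cos² u / (u + π/2) = ∫_{π/2}^{Y} sin² v / v ≤ S(Y)`
  have h2 : ∫ u in (0 : ℝ)..X, Real.cos u ^ 2 / (u + π / 2) = ∫ v in (π / 2)..Y, sinSqDiv v := by
    have : ∀ u : ℝ, Real.cos u ^ 2 / (u + π / 2) = sinSqDiv (u + π / 2) := fun u ↦ by
      unfold sinSqDiv
      rw [Real.sin_add_pi_div_two]
    simp_rw [this]
    rw [intervalIntegral.integral_comp_add_right, zero_add, hY']
  have h3 : ∫ v in (π / 2)..Y, sinSqDiv v ≤ sinSqLogInt Y := by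
    unfold sinSqLogInt
    have hadd := intervalIntegral.integral_add_adjacent_intervals (μ := volume) (a := 0) (b := π / 2)
      (c := Y)
      (continuous_sinSqDiv.intervalIntegrable _ _) (continuous_sinSqDiv.intervalIntegrable _ _)
    have : 0 ≤ ∫ u in (0 : ℝ)..(π / 2), sinSqDiv u :=
      intervalIntegral.integral_nonneg hπ.le fun u hu ↦ sinSqDiv_nonneg hu.1
    linarith
  -- (3) the two integrands add up to `1/(u + π/2)`, with integral `log(2Y/π)`
  have h4 : (∫ u in (0 : ℝ)..X, Real.sin u ^ 2 / (u + π / 2)) +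
      ∫ u in (0 : ℝ)..X, Real.cos u ^ 2 / (u + π / 2) = Real.log (2 * Y / π) := by
    rw [← intervalIntegral.integral_add hcs.intervalIntegrable hcc.intervalIntegrable]
    have : ∀ u : ℝ, Real.sin u ^ 2 / (u + π / 2) + Real.cos u ^ 2 / (u + π / 2) =
        (fun v : ℝ ↦ v⁻¹) (u + π / 2) := fun u ↦ by
      simp only [← add_div, Real.sin_sq_add_cos_sq, one_div]
    simp_rw [this]
    rw [intervalIntegral.integral_comp_add_right, zero_add, hY', integral_inv_of_pos hπ (by linarith)]
    congr 1
    field_simp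
  -- (4) monotonicity `S(X) ≤ S(Y)`
  have h5 : sinSqLogInt X ≤ sinSqLogInt Y := sinSqLogInt_mono hX0 (by linarith)
  linarith

/-- Explicit threshold: `S(Y) > M` as soon as `Y ≥ π/2` and `Y > (π/2) e^{2M}`. [folklore] -/
theorem lt_sinSqLogInt_of_lt {Y M : ℝ} (hY : π / 2 ≤ Y) (hM : π / 2 * Real.exp (2 * M) < Y) :
    M < sinSqLogInt Y := by
  refine lt_of_lt_of_le ?_ (half_log_le_sinSqLogInt hY)
  have hπ : 0 < π := Real.pi_pos
  have h1 : Real.exp (2 * M) < 2 * Y / π := by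
    rw [lt_div_iff₀ hπ]
    linarith
  have h2 : 2 * M < Real.log (2 * Y / π) := by
    rw [← Real.log_exp (2 * M)]
    exact Real.log_lt_log (Real.exp_pos _) h1
  linarith

/-! ## Coercivity of the window energy on functions with vanishing low modes -/

/-- Partial sums of the increment expansion are bounded by the increment: for finite `F ⊆ ℤ`,
`Σ_{k ∈ F} 16a |ĉ_k|² sin²(πkt/4a) ≤ D_t(g)` (`0 ≤ t < a`). [folklore] -/
theorem sum_le_weilIncrement (ha : 0 < a) (hg : Continuous g)
    (hsupp : Function.support g ⊆ Icc (-a) a) (F : Finset ℤ) (ht0 : 0 ≤ t) (hta : t < a) :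
    ∑ k ∈ F, 16 * a * (‖winCoeff a g k‖ ^ 2 * Real.sin (π * k * t / (4 * a)) ^ 2) ≤
      weilIncrement g t :=
  sum_le_hasSum F (fun k _ ↦ by positivity) (hasSum_winCoeff_increment ha hg hsupp ht0 hta)

/-- The archimedean part of the energy dominates the weighted partial sums: for finite `F ⊆ ℤ` and
`0 < m ≤ 1`, `m < a`,
`∫₀^m (1/2t) Σ_{k∈F} 16a|ĉ_k|² sin²(πkt/4a) dt ≤ ∫₀^∞ e^{t/2}/(2 sinh t) D_t(g) dt`. [folklore] -/
theorem intervalIntegral_sum_le_archIntegral (ha : 0 < a) (hg : IsWeilTest g)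
    (hsupp : Function.support g ⊆ Icc (-a) a) (F : Finset ℤ) {m : ℝ} (hm0 : 0 < m) (hm1 : m ≤ 1)
    (hma : m < a) :
    ∫ t in (0 : ℝ)..m, 1 / (2 * t) *
        ∑ k ∈ F, 16 * a * (‖winCoeff a g k‖ ^ 2 * Real.sin (π * k * t / (4 * a)) ^ 2) ≤
      ∫ t in Ioi (0 : ℝ), weilArchDensity t * weilIncrement g t := by
  have hI := integrableOn_weilArchDensity_mul_weilIncrement hg
  have hgc : Continuous g := hg.1.continuous
  have hnn : 0 ≤ᵐ[volume.restrict (Ioi (0 : ℝ))]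
      fun t ↦ weilArchDensity t * weilIncrement g t :=
    ae_restrict_of_forall_mem measurableSet_Ioi fun t ht ↦
      mul_nonneg (weilArchDensity_pos ht).le (weilIncrement_nonneg g t)
  -- restrict the archimedean integral to `(0, m]`
  have hsub : ∫ t in Ioc (0 : ℝ) m, weilArchDensity t * weilIncrement g t ≤
      ∫ t in Ioi (0 : ℝ), weilArchDensity t * weilIncrement g t :=
    setIntegral_mono_set hI hnn (Eventually.of_forall Ioc_subset_Ioi_self)
  refine le_trans ?_ hsub
  rw [intervalIntegral.integral_of_le hm0.le]
  refine integral_mono_of_nonneg ?_ (hI.mono_set Ioc_subset_Ioi_self) ?_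
  · refine ae_restrict_of_forall_mem measurableSet_Ioc fun t ht ↦ mul_nonneg ?_ ?_
    · have := ht.1
      positivity
    · exact Finset.sum_nonneg fun k _ ↦ by positivity
  · refine ae_restrict_of_forall_mem measurableSet_Ioc fun t ht ↦ ?_
    have ht0 : 0 < t := ht.1
    have hD := sum_le_weilIncrement ha hgc hsupp F ht0.le (ht.2.trans_lt hma)
    have hw := inv_two_mul_le_weilArchDensity ht0 (ht.2.trans hm1)
    calc 1 / (2 * t) * ∑ k ∈ F, 16 * a * (‖winCoeff a g k‖ ^ 2 * Real.sin (π * k * t / (4 * a)) ^ 2)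
        ≤ 1 / (2 * t) * weilIncrement g t := mul_le_mul_of_nonneg_left hD (by positivity)
      _ ≤ weilArchDensity t * weilIncrement g t :=
          mul_le_mul_of_nonneg_right hw (weilIncrement_nonneg g t)

/-- Evaluation of the weighted partial sums:
`∫₀^m (1/2t) Σ_{k∈F} 16a|ĉ_k|² sin²(πkt/4a) dt = Σ_{k∈F} 8a|ĉ_k|² ∫₀^m sin²(πkt/4a)/t dt`.
[folklore] -/
theorem intervalIntegral_sum_eq (a m : ℝ) (g : ℝ → ℂ) (F : Finset ℤ) :
    ∫ t in (0 : ℝ)..m, 1 / (2 * t) *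
        ∑ k ∈ F, 16 * a * (‖winCoeff a g k‖ ^ 2 * Real.sin (π * k * t / (4 * a)) ^ 2) =
      ∑ k ∈ F, 8 * a * ‖winCoeff a g k‖ ^ 2 *
        ∫ t in (0 : ℝ)..m, Real.sin (π * k / (4 * a) * t) ^ 2 / t := by
  have hpt : ∀ t : ℝ, 1 / (2 * t) *
      ∑ k ∈ F, 16 * a * (‖winCoeff a g k‖ ^ 2 * Real.sin (π * k * t / (4 * a)) ^ 2) =
      ∑ k ∈ F, 8 * a * ‖winCoeff a g k‖ ^ 2 * (Real.sin (π * k / (4 * a) * t) ^ 2 / t) := by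
    intro t
    rw [Finset.mul_sum]
    refine Finset.sum_congr rfl fun k _ ↦ ?_
    rw [show π * k * t / (4 * a) = π * k / (4 * a) * t by ring]
    by_cases ht : t = 0
    · simp [ht]
    · field_simp
      ring
  simp_rw [hpt]
  rw [intervalIntegral.integral_finsetSum fun (k : ℤ) _ ↦
    ((continuous_sin_sq_mul_div (π * (k : ℝ) / (4 * a))).intervalIntegrable 0 m).const_mul
      (8 * a * ‖winCoeff a g k‖ ^ 2)]
  refine Finset.sum_congr rfl fun k _ ↦ ?_
  exact intervalIntegral.integral_const_mul _ _

/-- **Coercivity (GAL-7 engine).**  Let `g` be a Weil test function supported in `[-a, a]` whose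
doubled-window Fourier coefficients `ĉ_k` vanish for `|k| ≤ N`.  Then, with `m = min(1, a/2)` and
`S(X) = ∫₀^X sin²u/u du`,
`2 · S(π (N+1) m / 4a) · ‖g‖₂² ≤ 𝓔_a(g)`:
the Dirichlet energy of the window controls `‖g‖²` with a constant growing like `½ log N`
(`half_log_le_sinSqLogInt`).  Mechanism: `𝓔_a ≥ ∫₀^m D_t/(2t) dt` and
`D_t = 16a Σ |ĉ_k|² sin²(πkt/4a)` (increment Parseval), so each surviving mode `|k| > N` contributes
`8a |ĉ_k|² S(π|k|m/4a) ≥ 8a |ĉ_k|² S(π(N+1)m/4a)`, and `Σ |ĉ_k|² = ‖g‖²/4a`.  RH-free; no hypothesis on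
the zeros. [cite: Yoshida1992, Lemma 3 (kernel form, different proof)] -/
theorem weilDirichletEnergy_ge_of_winCoeff_eq_zero (ha : 0 < a) (hg : IsWeilTest g)
    (hsupp : Function.support g ⊆ Icc (-a) a) {N : ℕ}
    (hvan : ∀ k : ℤ, |k| ≤ N → winCoeff a g k = 0) :
    2 * sinSqLogInt (π * (N + 1) * min 1 (a / 2) / (4 * a)) * ∫ x, ‖g x‖ ^ 2 ≤
      weilDirichletEnergy a g := by
  set m : ℝ := min 1 (a / 2) with hm
  have hm0 : 0 < m := lt_min one_pos (by linarith)
  have hm1 : m ≤ 1 := min_le_left _ _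
  have hma : m < a := (min_le_right _ _).trans_lt (by linarith)
  set SN : ℝ := sinSqLogInt (π * (N + 1) * m / (4 * a)) with hSN
  have hgc : Continuous g := hg.1.continuous
  -- per-mode lower bound: `SN |ĉ_k|² ≤ |ĉ_k|² ∫₀^m sin²(πkt/4a)/t dt`
  have hmode : ∀ k : ℤ, SN * ‖winCoeff a g k‖ ^ 2 ≤
      ‖winCoeff a g k‖ ^ 2 * ∫ t in (0 : ℝ)..m, Real.sin (π * k / (4 * a) * t) ^ 2 / t := by
    intro k
    by_cases hk : |k| ≤ N
    · simp [hvan k hk]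
    · have hk1 : (N : ℝ) + 1 ≤ |(k : ℝ)| := by
        have h' : (N : ℤ) + 1 ≤ |k| := by omega
        have h'' : ((N : ℤ) + 1 : ℝ) ≤ ((|k| : ℤ) : ℝ) := by exact_mod_cast h'
        simpa [Int.cast_abs] using h''
      have hkpos : 0 < |(k : ℝ)| := by linarith [show (0 : ℝ) ≤ N from Nat.cast_nonneg N]
      have hc : 0 < π * |(k : ℝ)| / (4 * a) := by positivity
      have heq : ∫ t in (0 : ℝ)..m, Real.sin (π * k / (4 * a) * t) ^ 2 / t =
          sinSqLogInt (π * |(k : ℝ)| / (4 * a) * m) := by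
        have hsq : ∀ t : ℝ, Real.sin (π * k / (4 * a) * t) ^ 2 =
            Real.sin (π * |(k : ℝ)| / (4 * a) * t) ^ 2 := by
          intro t
          rcases abs_choice (k : ℝ) with h | h
          · rw [h]
          · rw [h, show π * -(k : ℝ) / (4 * a) * t = -(π * k / (4 * a) * t) by ring, Real.sin_neg,
              neg_sq]
        simp_rw [hsq]
        exact integral_sin_sq_div_eq_sinSqLogInt hc m
      rw [heq]
      have hmono : SN ≤ sinSqLogInt (π * |(k : ℝ)| / (4 * a) * m) := by
        apply sinSqLogInt_mono (by positivity)
        rw [show π * |(k : ℝ)| / (4 * a) * m = π * |(k : ℝ)| * m / (4 * a) by ring]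
        apply div_le_div_of_nonneg_right _ (by positivity)
        have := mul_le_mul_of_nonneg_right hk1 (mul_nonneg Real.pi_pos.le hm0.le)
        nlinarith
      nlinarith [sq_nonneg ‖winCoeff a g k‖]
  -- for every finite `F`: `8a SN Σ_F |ĉ_k|² ≤ ∫₀^∞ w D`
  have hA : ∀ F : Finset ℤ, ∑ k ∈ F, 8 * a * SN * ‖winCoeff a g k‖ ^ 2 ≤
      ∫ t in Ioi (0 : ℝ), weilArchDensity t * weilIncrement g t := by
    intro F
    refine le_trans ?_ (intervalIntegral_sum_le_archIntegral ha hg hsupp F hm0 hm1 hma)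
    rw [intervalIntegral_sum_eq]
    refine Finset.sum_le_sum fun k _ ↦ ?_
    have := hmode k
    nlinarith [this, ha.le]
  -- sum over all modes with Parseval `Σ |ĉ_k|² = ‖g‖² / 4a`
  have hP := (hasSum_norm_sq_winCoeff ha hgc hsupp).mul_left (8 * a * SN)
  have hle := hasSum_le_of_sum_le hP hA
  have hprime : 0 ≤ ∑ n ∈ weilPrimeIndex a,
      (ArithmeticFunction.vonMangoldt n : ℝ) / Real.sqrt n * weilIncrement g (Real.log n) :=
    Finset.sum_nonneg fun n _ ↦ mul_nonneg
      (div_nonneg ArithmeticFunction.vonMangoldt_nonneg (Real.sqrt_nonneg _)) (weilIncrement_nonneg g _)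
  have h84 : 8 * a * SN * ((4 * a)⁻¹ * ∫ x, ‖g x‖ ^ 2) = 2 * SN * ∫ x, ‖g x‖ ^ 2 := by
    field_simp
    ring
  rw [h84] at hle
  unfold weilDirichletEnergy
  linarith

end Summit.RiemannHypothesis.RiemannHypothesis.Theorems.PfPersistence

end
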